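import Summits.ResolutionOfSingularities.ResolutionOfSingularities.Theorems.FrobeniusLadderFInjectiveMacaulayficationWFixAtNonClosedDimTwo
import Summits.ResolutionOfSingularities.ResolutionOfSingularities.Theorems.FrobeniusLadderFInjectiveMacaulayficationClosedCentreDimEq3
import Summits.ResolutionOfSingularities.ResolutionOfSingularities.Theorems.FrobeniusLadderFInjectiveMacaulayficationPointFixWildOfPFW
import HarnessLib

/-!
# Hole #3 in (A′)-currency, local dimensions 2 AND 3, tame OR wild: the LocFix-(A′) datum at every non-closed bad point `η` with
# `2 ≤ dim 𝒪_η ≤ 3` and good proper generizations — from Lipman 1978 (dim 2) and Cossart–Piltant 2019 (dim 3) by the generic-fibre transfer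
# (crux `FInjectiveMacaulayfication` stmt-ResolutionOfSingularities-15315, chain w45a; sequel of `…WFixAtNonClosedDimTwo` (p564051);
# res-L1-w45a-plan-1 R16.3 (4) «the wild stratum lives in (A′)-currency»; seat res-L1-w45a-stub-3)

[OURS · L1 W4.5a · res-L1-w45a-stub-3] Support file (`--supports stmt-ResolutionOfSingularities-15315 --as helper`) for the crux
`FrobeniusLadder.FInjectiveMacaulayfication`; NOT a statement of any manuscript; AI-written, weaker than expert review. No definition and no
named fact is introduced; Lipman 1978 (`Lipman1978SequenceFinite`), Cossart–Piltant 2019 (`CossartPiltant2019General`, `Stacks081R`,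
`CossartPiltant2019Principalization`), Datta–Murayama 2024 Thm. B (`DattaMurayama2024_fInjectiveLocusOpen`) and `NonFullLocusClosed.CMLocusOpen`
enter BY NAME as hypotheses.

THE POINT. In (A′)-currency — a nonzero centre `(c′) ⊆ 𝔪_η` with NO radical condition, all affine blow-up charts FULL at the primes over
`𝔪_η` (the LocFix conjunct of `FCUnguardedRungs.FCUnguardedDimGe4`, l.220–228) — the tame/wild distinction at `η` DISAPPEARS in local
dimensions 2 and 3: the tree's closed-point producers `TameWildSplit.closedCentreExistsAffineDimLe2_of_lipman : ClosedCentreExistsAffineDimLe 2`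
(p554313; tame side `H4LocTameDim2` + wild side `WFixClosedAffineDim2OfLipman`, both from Lipman) and
`ClosedCentreDimEq3.closedCentreExistsDimEq3_of_cp : ClosedCentreExistsDimEq3` (the Cossart–Piltant one-blow-up resolution of a threefold) give a
`CentreData` at EVERY bad closed point, normal or not; the generic-fibre model (`GenericFibreModel.genericFibreModel`) turns the non-closed `η`
into a closed point `b` of an admissible `X₀` over `K₀` with `dim X₀ = dim 𝒪_{X₀,b} = dim 𝒪_{X₁,η}`
(`WFixAtNonClosedDimTwo.topologicalKrullDim_eq_ringKrullDim_stalk_of_isClosed`), the adapter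
`WFixAtNonClosedDimTwo.locFixAprime_of_centreData` reads the (A′)-datum off the `CentreData`, and
`WFixAtNonClosedDimTwo.locFixAprime_of_ringEquiv` transports it to `𝒪_{X₁,η}`. So:

* `locFixAprime_atNonClosed_dimTwo_of_lipman (hL) (hDM) (hCMo)` — `dim 𝒪_η = 2`, NO normality hypothesis either way (supersedes the wild-only
  `WFixAtNonClosedDimTwo.locFixAprime_atNonClosedWild_dimTwo_of_lipman`, whose extra hypothesis `¬ IsIntegrallyClosed 𝒪_η` is idle here);
* `locFixAprime_atNonClosed_dimThree_of_cp (hG) (h081R) (hP) (hDM) (hCMo)` — `dim 𝒪_η = 3`;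
* `locFixAprime_atNonClosed_lowDim (hL) (hG) (h081R) (hP) (hDM) (hCMo)` — `2 ≤ dim 𝒪_η ≤ 3`: the binders of strat-1's FC2Dim4Sig v0.5
  `PointFixAtNonClosedWild` VERBATIM MINUS `¬ IsIntegrallyClosed 𝒪_η`, conclusion = its (A′) conjunct `LocFixData` (l.220–228 of
  `FCUnguardedDimGe4`, verbatim, `FullCl` unfolded).

What this does NOT give (honest status): the PRIMARY datum (`√(c′) = 𝔪_η`) — refuted at wild points by Theorem W (plan-1 R16.2/R16.3), open
at normal points of local dimension 3 (`PointFixAtNonClosedNormal`); and nothing about the SPREAD of a non-primary centre (FC″'s (nc)/(cl)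
clauses away from `η`), which is where the (A′)-currency pays: `supp J ⊋ closure {η}`.
-/

-- single-problem summit: the doubled namespace component is forced
set_option linter.dupNamespace false

noncomputable section

open AlgebraicGeometry CategoryTheory Literature.AlgebraicGeometry.Resolution TopologicalSpace IsLocalRing Order

namespace Summit.ResolutionOfSingularities.ResolutionOfSingularities.Theorems.FInjectiveMacaulayfication.LocFixAtNonClosedLowDim

open Summit.ResolutionOfSingularities.ResolutionOfSingularities.Theorems.FInjectiveMacaulayfication

/-! ## §1 The closed-point model in the right dimension -/

/-- **The generic-fibre model with its dimension**: under the hypotheses of the rungs below (good locus open via #2 + `CMLocusOpen`), a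
non-closed bad `η` with good proper generizations and `dim 𝒪_η = d` has a CLOSED avatar `b` on an admissible `X₀` of dimension `d` with finite
bad locus and `𝒪_{X₀,b} ≃+* 𝒪_{X₁,η}`. [folklore assembly; cite: DattaMurayama2024, Thm. B] -/
theorem exists_model_of_dim
    (hDM : Literature.AlgebraicGeometry.Resolution.DattaMurayama2024_fInjectiveLocusOpen.{0})
    (hCMo : NonFullLocusClosed.CMLocusOpen) {p : ℕ} (hp : p.Prime) {k : Type} [Field k] [CharP k p]
    {X₁ : Scheme.{0}} (f₁ : X₁ ⟶ Spec (.of k)) [LocallyOfFiniteType f₁] [QuasiCompact f₁] [IsIntegral X₁]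
    (hCM : ∀ x : X₁, SliceableCentre.CMCl (X₁.presheaf.stalk x)) {η : X₁} (hbad : ¬ SliceableCentre.FCl p (X₁.presheaf.stalk η))
    {d : ℕ} (hdim : ringKrullDim (X₁.presheaf.stalk η) = d)
    (hgen : ∀ y : X₁, y ⤳ η → y ≠ η → SliceableCentre.FCl p (X₁.presheaf.stalk y)) :
    ∃ (K₀ : Type) (_ : Field K₀) (_ : CharP K₀ p) (X₀ : Scheme.{0}) (f₀ : X₀ ⟶ Spec (.of K₀)),
      IsSeparated f₀ ∧ LocallyOfFiniteType f₀ ∧ QuasiCompact f₀ ∧ IsIntegral X₀ ∧ topologicalKrullDim X₀ = d ∧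
      (∀ x : X₀, SliceableCentre.CMCl (X₀.presheaf.stalk x)) ∧ Set.Finite {x : X₀ | ¬ SliceableCentre.FCl p (X₀.presheaf.stalk x)} ∧
      ∃ b : X₀, IsClosed ({b} : Set X₀) ∧ ¬ SliceableCentre.FCl p (X₀.presheaf.stalk b) ∧
        Nonempty (X₀.presheaf.stalk b ≃+* X₁.presheaf.stalk η) := by
  have hclosed := NonFullLocusClosed.nonFullLocusClosed_of_named hDM hCMo p hp k X₁ f₁ inferInstance inferInstance inferInstance
  have hopen : IsOpen {x : X₁ | SliceableCentre.FCl p (X₁.presheaf.stalk x)} := by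
    have hset : {x : X₁ | SliceableCentre.FCl p (X₁.presheaf.stalk x)} =
        {x : X₁ | ¬ NonFullLocusClosed.Clause p (X₁.presheaf.stalk x)}ᶜ := by
      ext x
      simp only [Set.mem_setOf_eq, Set.mem_compl_iff, not_not]
      rw [NonFullLocusClosed.clause_iff]
      exact ⟨fun h => ⟨hCM x, h⟩, fun h => h.2⟩
    rw [hset]
    exact hclosed.isOpen_compl
  obtain ⟨K₀, instF, instC, X₀, f₀, hsep₀, hft₀, hqc₀, hint₀, hCM₀, hfin₀, b, hbcl, hbbad, ⟨e⟩⟩ :=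
    GenericFibreModel.genericFibreModel p hp k X₁ f₁ inferInstance inferInstance hCM hopen η hbad hgen
  haveI := hft₀
  haveI := hint₀
  refine ⟨K₀, instF, instC, X₀, f₀, hsep₀, hft₀, hqc₀, hint₀, ?_, hCM₀, hfin₀, b, hbcl, hbbad, ⟨e⟩⟩
  rw [WFixAtNonClosedDimTwo.topologicalKrullDim_eq_ringKrullDim_stalk_of_isClosed f₀ hbcl, ringKrullDim_eq_of_ringEquiv e, hdim]

/-! ## §2 The rungs -/

/-- **(A′) LocFix at a non-closed bad point of local dimension 2 ⟸ Lipman 1978** (tame or wild): `CentreData` at the closed avatar `b` on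
an affine open of the 2-dimensional model (`TameWildSplit.closedCentreExistsAffineDimLe2_of_lipman`), adapter, transport.
[folklore assembly; cite: Lipman1978, Thm. (desingularization of excellent surfaces); DattaMurayama2024, Thm. B] -/
theorem locFixAprime_atNonClosed_dimTwo_of_lipman
    (hL : Literature.AlgebraicGeometry.Resolution.Lipman1978SequenceFinite.{0})
    (hDM : Literature.AlgebraicGeometry.Resolution.DattaMurayama2024_fInjectiveLocusOpen.{0})
    (hCMo : NonFullLocusClosed.CMLocusOpen) :
    ∀ (p : ℕ), p.Prime → ∀ (k : Type) [Field k] [CharP k p]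
    (X₁ : Scheme.{0}) (f₁ : X₁ ⟶ Spec (.of k)),
      IsSeparated f₁ → LocallyOfFiniteType f₁ → QuasiCompact f₁ → IsIntegral X₁ → 4 ≤ topologicalKrullDim X₁ →
      (∀ x : X₁, SliceableCentre.CMCl (X₁.presheaf.stalk x)) →
      ∀ η : X₁, ¬ IsClosed ({η} : Set X₁) → ¬ SliceableCentre.FCl p (X₁.presheaf.stalk η) →
        ringKrullDim (X₁.presheaf.stalk η) = (2 : ℕ) →
        (∀ y : X₁, y ⤳ η → y ≠ η → SliceableCentre.FCl p (X₁.presheaf.stalk y)) →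
        ∃ (n' : ℕ) (c' : Fin n' → X₁.presheaf.stalk η),
      Ideal.span (Set.range c') ≠ ⊥ ∧ Ideal.span (Set.range c') ≤ maximalIdeal (X₁.presheaf.stalk η) ∧
        (∀ (j : Fin n') (𝔔 : PrimeSpectrum (blowupAlgebra (Ideal.span (Set.range c')) (c' j))),
          𝔔.asIdeal.comap (algebraMap (X₁.presheaf.stalk η) (blowupAlgebra (Ideal.span (Set.range c')) (c' j))) =
            maximalIdeal (X₁.presheaf.stalk η) →
          IsDomain (Localization.AtPrime 𝔔.asIdeal) ∧ ∀ d : ℕ, ringKrullDim (Localization.AtPrime 𝔔.asIdeal) = d →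
            ∀ s : Fin d → Localization.AtPrime 𝔔.asIdeal, (Ideal.span (Set.range s)).radical.IsMaximal →
              RingTheory.Sequence.IsWeaklyRegular (Localization.AtPrime 𝔔.asIdeal) (List.ofFn s) ∧
              ∀ y : Localization.AtPrime 𝔔.asIdeal, (∃ e : ℕ, y ^ p ^ e ∈ Ideal.span ((fun z : Localization.AtPrime 𝔔.asIdeal => z ^ p ^ e) ''
                (Ideal.span (Set.range s) : Set (Localization.AtPrime 𝔔.asIdeal)))) → y ∈ Ideal.span (Set.range s)) := by
  intro p hp k _ _ X₁ f₁ _ hft hqc hint _ hCM η _ hbad hdim hgen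
  haveI := hft
  haveI := hqc
  haveI := hint
  obtain ⟨K₀, instF, instC, X₀, f₀, hsep₀, hft₀, hqc₀, hint₀, hdim₀, hCM₀, hfin₀, b, hbcl, hbbad, ⟨e⟩⟩ :=
    exists_model_of_dim hDM hCMo hp f₁ hCM hbad hdim hgen
  haveI := hsep₀
  haveI := hft₀
  haveI := hqc₀
  haveI := hint₀
  -- an affine open `U ∋ b` and the restricted data
  obtain ⟨U, hU, hbU, -⟩ := exists_isAffineOpen_mem_and_subset (X := X₀) (x := b) (U := ⊤) (Opens.mem_top b)
  haveI : IsAffine (U : Scheme.{0}) := hU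
  obtain ⟨hintU, hCMU, hfinU⟩ := WFixAtNonClosedDimTwo.admissible_restrict p hCM₀ hfin₀ U hbU
  haveI := hintU
  have hdimU : topologicalKrullDim (U : Scheme.{0}) ≤ (2 : ℕ) := by
    have h := U.ι.isOpenEmbedding.isInducing.topologicalKrullDim_le
    rw [hdim₀] at h
    exact h
  let b' : (U : Scheme.{0}) := ⟨b, hbU⟩
  have eU : (U : Scheme.{0}).presheaf.stalk b' ≃+* X₀.presheaf.stalk b := (U.stalkIso b').commRingCatIsoToRingEquiv
  have hbcl' : IsClosed ({b'} : Set (U : Scheme.{0})) := WFixAtNonClosedDimTwo.isClosed_singleton_restrict U hbU hbcl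
  have hbbad' : ¬ SliceableCentre.FCl p ((U : Scheme.{0}).presheaf.stalk b') :=
    fun h => hbbad (FiLocusOpenOfAffine.fClause_of_ringEquiv p eU h)
  -- #4β for affine surfaces (Lipman), tame or wild
  have hC : SliceableCentre.CentreData p (U : Scheme.{0}) b' :=
    TameWildSplit.closedCentreExistsAffineDimLe2_of_lipman hL p hp K₀ (U : Scheme.{0}) (U.ι ≫ f₀) inferInstance inferInstance
      inferInstance hintU hdimU hU hCMU hfinU b' hbcl' hbbad'
  haveI : IsLocallyNoetherian (U : Scheme.{0}) := LocallyOfFiniteType.isLocallyNoetherian (U.ι ≫ f₀)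
  have hA := WFixAtNonClosedDimTwo.locFixAprime_of_centreData p (X := (U : Scheme.{0})) b' hC
  exact WFixAtNonClosedDimTwo.locFixAprime_of_ringEquiv p (eU.trans e) hA

/-- **(A′) LocFix at a non-closed bad point of local dimension 3 ⟸ Cossart–Piltant 2019** (tame or wild): `CentreData` at the closed
avatar `b` on the 3-dimensional model (`ClosedCentreDimEq3.closedCentreExistsDimEq3_of_cp`: the centre `𝓛` of the one-blow-up resolution),
adapter, transport. [folklore assembly; cite: CossartPiltant2019, Thm. 1.1; DattaMurayama2024, Thm. B] -/
theorem locFixAprime_atNonClosed_dimThree_of_cp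
    (hG : Literature.AlgebraicGeometry.Resolution.CossartPiltant2019General.{0})
    (h081R : Literature.AlgebraicGeometry.Resolution.Stacks081R.{0})
    (hP : Literature.AlgebraicGeometry.Resolution.CossartPiltant2019Principalization.{0})
    (hDM : Literature.AlgebraicGeometry.Resolution.DattaMurayama2024_fInjectiveLocusOpen.{0})
    (hCMo : NonFullLocusClosed.CMLocusOpen) :
    ∀ (p : ℕ), p.Prime → ∀ (k : Type) [Field k] [CharP k p]
    (X₁ : Scheme.{0}) (f₁ : X₁ ⟶ Spec (.of k)),
      IsSeparated f₁ → LocallyOfFiniteType f₁ → QuasiCompact f₁ → IsIntegral X₁ → 4 ≤ topologicalKrullDim X₁ →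
      (∀ x : X₁, SliceableCentre.CMCl (X₁.presheaf.stalk x)) →
      ∀ η : X₁, ¬ IsClosed ({η} : Set X₁) → ¬ SliceableCentre.FCl p (X₁.presheaf.stalk η) →
        ringKrullDim (X₁.presheaf.stalk η) = (3 : ℕ) →
        (∀ y : X₁, y ⤳ η → y ≠ η → SliceableCentre.FCl p (X₁.presheaf.stalk y)) →
        ∃ (n' : ℕ) (c' : Fin n' → X₁.presheaf.stalk η),
      Ideal.span (Set.range c') ≠ ⊥ ∧ Ideal.span (Set.range c') ≤ maximalIdeal (X₁.presheaf.stalk η) ∧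
        (∀ (j : Fin n') (𝔔 : PrimeSpectrum (blowupAlgebra (Ideal.span (Set.range c')) (c' j))),
          𝔔.asIdeal.comap (algebraMap (X₁.presheaf.stalk η) (blowupAlgebra (Ideal.span (Set.range c')) (c' j))) =
            maximalIdeal (X₁.presheaf.stalk η) →
          IsDomain (Localization.AtPrime 𝔔.asIdeal) ∧ ∀ d : ℕ, ringKrullDim (Localization.AtPrime 𝔔.asIdeal) = d →
            ∀ s : Fin d → Localization.AtPrime 𝔔.asIdeal, (Ideal.span (Set.range s)).radical.IsMaximal →
              RingTheory.Sequence.IsWeaklyRegular (Localization.AtPrime 𝔔.asIdeal) (List.ofFn s) ∧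
              ∀ y : Localization.AtPrime 𝔔.asIdeal, (∃ e : ℕ, y ^ p ^ e ∈ Ideal.span ((fun z : Localization.AtPrime 𝔔.asIdeal => z ^ p ^ e) ''
                (Ideal.span (Set.range s) : Set (Localization.AtPrime 𝔔.asIdeal)))) → y ∈ Ideal.span (Set.range s)) := by
  intro p hp k _ _ X₁ f₁ _ hft hqc hint _ hCM η _ hbad hdim hgen
  haveI := hft
  haveI := hqc
  haveI := hint
  obtain ⟨K₀, instF, instC, X₀, f₀, hsep₀, hft₀, hqc₀, hint₀, hdim₀, hCM₀, hfin₀, b, hbcl, hbbad, ⟨e⟩⟩ :=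
    exists_model_of_dim hDM hCMo hp f₁ hCM hbad hdim hgen
  haveI := hft₀
  haveI := hint₀
  have hdim₀' : topologicalKrullDim X₀ = 3 := by rw [hdim₀]; rfl
  -- #4β for threefolds (Cossart–Piltant), tame or wild
  have hC : SliceableCentre.CentreData p X₀ b :=
    ClosedCentreDimEq3.closedCentreExistsDimEq3_of_cp hG h081R hP p hp K₀ X₀ f₀ hsep₀ hft₀ hqc₀ hint₀ hdim₀' hCM₀ hfin₀ b hbcl hbbad
  haveI : IsLocallyNoetherian X₀ := LocallyOfFiniteType.isLocallyNoetherian f₀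
  exact WFixAtNonClosedDimTwo.locFixAprime_of_ringEquiv p e (WFixAtNonClosedDimTwo.locFixAprime_of_centreData p b hC)

/-- **(A′) LocFix at every non-closed bad point of local dimension 2 or 3 ⟸ Lipman 1978 + Cossart–Piltant 2019** (+ #2 and `CMLocusOpen`
for the openness of the good locus): the binders of FC2Dim4Sig v0.5 `PointFixAtNonClosedWild` minus `¬ IsIntegrallyClosed 𝒪_η`, conclusion
its (A′) conjunct. [folklore assembly; cite: Lipman1978; CossartPiltant2019, Thm. 1.1; DattaMurayama2024, Thm. B] -/
theorem locFixAprime_atNonClosed_lowDim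
    (hL : Literature.AlgebraicGeometry.Resolution.Lipman1978SequenceFinite.{0})
    (hG : Literature.AlgebraicGeometry.Resolution.CossartPiltant2019General.{0})
    (h081R : Literature.AlgebraicGeometry.Resolution.Stacks081R.{0})
    (hP : Literature.AlgebraicGeometry.Resolution.CossartPiltant2019Principalization.{0})
    (hDM : Literature.AlgebraicGeometry.Resolution.DattaMurayama2024_fInjectiveLocusOpen.{0})
    (hCMo : NonFullLocusClosed.CMLocusOpen) :
    ∀ (p : ℕ), p.Prime → ∀ (k : Type) [Field k] [CharP k p]
    (X₁ : Scheme.{0}) (f₁ : X₁ ⟶ Spec (.of k)),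
      IsSeparated f₁ → LocallyOfFiniteType f₁ → QuasiCompact f₁ → IsIntegral X₁ → 4 ≤ topologicalKrullDim X₁ →
      (∀ x : X₁, SliceableCentre.CMCl (X₁.presheaf.stalk x)) →
      ∀ η : X₁, ¬ IsClosed ({η} : Set X₁) → ¬ SliceableCentre.FCl p (X₁.presheaf.stalk η) →
        2 ≤ ringKrullDim (X₁.presheaf.stalk η) → ringKrullDim (X₁.presheaf.stalk η) ≤ 3 →
        (∀ y : X₁, y ⤳ η → y ≠ η → SliceableCentre.FCl p (X₁.presheaf.stalk y)) →
        ∃ (n' : ℕ) (c' : Fin n' → X₁.presheaf.stalk η),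
      Ideal.span (Set.range c') ≠ ⊥ ∧ Ideal.span (Set.range c') ≤ maximalIdeal (X₁.presheaf.stalk η) ∧
        (∀ (j : Fin n') (𝔔 : PrimeSpectrum (blowupAlgebra (Ideal.span (Set.range c')) (c' j))),
          𝔔.asIdeal.comap (algebraMap (X₁.presheaf.stalk η) (blowupAlgebra (Ideal.span (Set.range c')) (c' j))) =
            maximalIdeal (X₁.presheaf.stalk η) →
          IsDomain (Localization.AtPrime 𝔔.asIdeal) ∧ ∀ d : ℕ, ringKrullDim (Localization.AtPrime 𝔔.asIdeal) = d →
            ∀ s : Fin d → Localization.AtPrime 𝔔.asIdeal, (Ideal.span (Set.range s)).radical.IsMaximal →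
              RingTheory.Sequence.IsWeaklyRegular (Localization.AtPrime 𝔔.asIdeal) (List.ofFn s) ∧
              ∀ y : Localization.AtPrime 𝔔.asIdeal, (∃ e : ℕ, y ^ p ^ e ∈ Ideal.span ((fun z : Localization.AtPrime 𝔔.asIdeal => z ^ p ^ e) ''
                (Ideal.span (Set.range s) : Set (Localization.AtPrime 𝔔.asIdeal)))) → y ∈ Ideal.span (Set.range s)) := by
  intro p hp k _ _ X₁ f₁ hsep hft hqc hint h4 hCM η hη hbad h2 h3 hgen
  rcases PointFixWildOfPFW.eq_two_or_eq_three h2 h3 with h | h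
  · exact locFixAprime_atNonClosed_dimTwo_of_lipman hL hDM hCMo p hp k X₁ f₁ hsep hft hqc hint h4 hCM η hη hbad h hgen
  · exact locFixAprime_atNonClosed_dimThree_of_cp hG h081R hP hDM hCMo p hp k X₁ f₁ hsep hft hqc hint h4 hCM η hη hbad h hgen

end Summit.ResolutionOfSingularities.ResolutionOfSingularities.Theorems.FInjectiveMacaulayfication.LocFixAtNonClosedLowDim

end
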